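import Literature.Probability.LatticeModels.SixVertexGFFSpectralMeasure
import Literature.Probability.LatticeModels.SixVertexSpectralXi
import Literature.MeasureTheory.Integral.LaplaceTransformUnique

/-!
# Identification of the limiting spectral measure (DKLM 2026, Part II, proof of Theorem 53)

H. Duminil-Copin, K. K. Kozlowski, P. Lammers, I. Manolescu, *Gaussian free field convergence of
the six-vertex model with `-1 ≤ Δ ≤ -1/2`*, arXiv:2603.06268 (2026) [DKLM2026SixVertexGFF]
(`paper:arxiv-2603.06268`, chunk p0036):

> **Theorem 53.** […] `lim_{δ→0} lim_{L→∞} μ_L^{(δ)} = ½(δ_{b=a} + δ_{b=-a}) · σ²/(2πa) da`.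
> Proof. […] It therefore suffices to show that any subsequential limit `μ` coincides with
> `½(δ_{b=a}+δ_{b=-a}) · σ²/(2πa) da`. […] `F(s,0) = σ²/(2πs)`. […] We already know that
> `μ[{|b| > a}] = 0`. […] We therefore obtain that `μ[{|b| < a}] = 0`. It remains to identify the
> marginal in the `a`-variable and show that `dμ(a) = σ²/(2πa) da`. By the definition and the
> formula for `F`, we get that for every `x > 0`, `∫ a e^{-ax} dμ(a) = σ²/(2πx)`. The right-hand side
> is precisely the Laplace transform of the measure `σ²/(2πa) da`. Since a `σ`-finite positive
> measure is uniquely determined by its Laplace transform, this identifies `μ` and completes the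
> proof.

This file proves the **final identification step** of Theorem 53: a positive measure `μ` on
`ℝ × ℝ` giving no mass to `{a ≤ 0}`, invariant under `(a,b) ↦ (a,-b)`, concentrated on
`{|b| = a}`, and with `∫ a e^{-ax} dμ(a,b) = σ²/(2πx)` for all `x > 0`, **is** the GFF spectral
measure `μ_σ = ½(δ_{b=a}+δ_{b=-a}) ⊗ σ²/(2πa) da` (`gffSpectralMeasure σ`). The inputs
`F(s,0) = σ²/(2πs)` and `μ{|b| ≠ a} = 0` (rotational invariance, Theorem 40, convergence to the
GFF) enter as hypotheses.

* `measure_eq_half_sum_map_of_concentrated` — a reflection-invariant measure concentrated on the two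
  diagonals is `½(diag_* μ₁ + adiag_* μ₁)`, `μ₁` its first marginal;
* `fst_marginal_eq_gffRadial` — Laplace-transform identification of the marginal
  (`Literature.MeasureTheory.Integral.ext_of_forall_lintegral_exp_neg_nat_mul_eq`);
* **`eq_gffSpectralMeasure_of_laplace` — the identification step of Theorem 53**, and its
  restatements for `μ ∈ 𝓜_{c,C}` with the hypotheses `F(x,0) = σ²/(2πx)`
  (`eq_gffSpectralMeasure_of_dklmF`) or `I_F(s) - I_F(1) = -(σ²/2π) log s`
  (`eq_gffSpectralMeasure_of_dklmIF`), `F`, `I_F` as in Definition 36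
  (`SixVertexSpectralFTransform.lean`);
* `concentrated_of_integral_sq_sub_sq_eq_zero`, `eq_gffSpectralMeasure_of_upper_of_Xi` — the same
  from the analytic inputs of the printed proof: `μ{|b| > a} = 0` (Theorem 40),
  `-Ξ'(1) = ∫ (a²-b²)e^{-a} dμ` (Theorem 46) and the `I_F` identity.

## References

* H. Duminil-Copin, K. K. Kozlowski, P. Lammers, I. Manolescu, arXiv:2603.06268 (2026), Part II,
  Theorem 53 and its proof. [DKLM2026SixVertexGFF]
-/

noncomputable section

open MeasureTheory Set Filter Topology
open scoped NNReal ENNReal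
open Literature.MeasureTheory.Integral

namespace Literature.Probability.LatticeModels.SixVertex

/-! ## 1. Reflection-invariant measures concentrated on the diagonals -/

/-- **Structure of reflection-invariant measures concentrated on `{|b| = a}`**: for every measurable
`S`, `μ(S) = ½ (μ₁(diag⁻¹ S) + μ₁(adiag⁻¹ S))`, where `μ₁ = fst_* μ` is the first marginal; i.e.
`μ = ½(diag_* μ₁ + adiag_* μ₁)`. [cite: DKLM2026SixVertexGFF, Part II, proof of Theorem 53] -/
theorem measure_eq_half_sum_map_of_concentrated {μ : Measure (ℝ × ℝ)}
    (hrefl : μ.map (fun p : ℝ × ℝ => (p.1, -p.2)) = μ) (hconc : μ {p : ℝ × ℝ | |p.2| ≠ p.1} = 0) :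
    μ = (2⁻¹ : ℝ≥0∞) • ((μ.map Prod.fst).map diagEmb + (μ.map Prod.fst).map adiagEmb) := by
  have hR : Measurable (fun p : ℝ × ℝ => (p.1, -p.2)) := measurable_fst.prodMk measurable_snd.neg
  -- the three pieces of the support
  set Dp : Set (ℝ × ℝ) := {p : ℝ × ℝ | p.2 = p.1 ∧ p.1 ≠ 0} with hDp
  set Dm : Set (ℝ × ℝ) := {p : ℝ × ℝ | p.2 = -p.1 ∧ p.1 ≠ 0} with hDm
  set O : Set (ℝ × ℝ) := {p : ℝ × ℝ | p.1 = 0 ∧ p.2 = 0} with hO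
  have mDp : MeasurableSet Dp :=
    (measurableSet_eq_fun measurable_snd measurable_fst).inter (measurableSet_eq_fun measurable_fst measurable_const).compl
  have mDm : MeasurableSet Dm :=
    (measurableSet_eq_fun measurable_snd measurable_fst.neg).inter (measurableSet_eq_fun measurable_fst measurable_const).compl
  have mO : MeasurableSet O :=
    (measurableSet_eq_fun measurable_fst measurable_const).inter (measurableSet_eq_fun measurable_snd measurable_const)
  have hnull : μ (Dp ∪ Dm ∪ O)ᶜ = 0 := by
    refine measure_mono_null (fun p hp => ?_) hconc
    simp only [mem_compl_iff, mem_union, mem_setOf_eq, not_or, not_and, hDp, hDm, hO] at hp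
    intro habs
    rcases eq_or_ne p.1 0 with h0 | h0
    · have hb : p.2 = 0 := by rw [h0, abs_eq_zero] at habs; exact habs
      exact hp.2 h0 hb
    · rcases abs_eq (le_of_lt (lt_of_le_of_ne (habs ▸ abs_nonneg p.2) (Ne.symm h0))) |>.1 habs with h | h
      · exact hp.1.1 h h0
      · exact hp.1.2 h h0
  -- decomposition of the mass of any measurable set
  have hdec : ∀ T : Set (ℝ × ℝ), MeasurableSet T → μ T = μ (T ∩ Dp) + μ (T ∩ Dm) + μ (T ∩ O) := by
    intro T hT
    have hcov : μ T = μ (T ∩ (Dp ∪ Dm ∪ O)) := by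
      refine le_antisymm ?_ (measure_mono inter_subset_left)
      calc μ T ≤ μ (T ∩ (Dp ∪ Dm ∪ O) ∪ (Dp ∪ Dm ∪ O)ᶜ) := measure_mono fun p hp => by
            by_cases h : p ∈ Dp ∪ Dm ∪ O
            · exact Or.inl ⟨hp, h⟩
            · exact Or.inr h
        _ ≤ μ (T ∩ (Dp ∪ Dm ∪ O)) + μ (Dp ∪ Dm ∪ O)ᶜ := measure_union_le _ _
        _ = μ (T ∩ (Dp ∪ Dm ∪ O)) := by rw [hnull, add_zero]
    have d1 : Disjoint (T ∩ Dp) (T ∩ Dm) := by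
      refine disjoint_left.2 fun p hp hq => hp.2.2 ?_
      have h1 := hp.2.1; have h2 := hq.2.1
      linarith
    have d2 : Disjoint (T ∩ Dp ∪ T ∩ Dm) (T ∩ O) := by
      refine disjoint_left.2 fun p hp hq => ?_
      rcases hp with hp | hp
      · exact hp.2.2 hq.2.1
      · exact hp.2.2 hq.2.1
    rw [hcov, inter_union_distrib_left, inter_union_distrib_left, measure_union d2 (hT.inter mO),
      measure_union d1 (hT.inter mDm)]
  ext S hS
  set A : Set (ℝ × ℝ) := {p : ℝ × ℝ | (p.1, p.1) ∈ S} with hA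
  set B : Set (ℝ × ℝ) := {p : ℝ × ℝ | (p.1, -p.1) ∈ S} with hB
  have mA : MeasurableSet A := hS.preimage (measurable_fst.prodMk measurable_fst)
  have mB : MeasurableSet B := hS.preimage (measurable_fst.prodMk measurable_fst.neg)
  -- the right-hand side in terms of `A`, `B`
  have hRHS : ((2⁻¹ : ℝ≥0∞) • ((μ.map Prod.fst).map diagEmb + (μ.map Prod.fst).map adiagEmb)) S =
      2⁻¹ * (μ A + μ B) := by
    rw [Measure.smul_apply, smul_eq_mul, Measure.add_apply, Measure.map_apply measurable_diagEmb hS,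
      Measure.map_apply measurable_adiagEmb hS, Measure.map_apply measurable_fst (measurable_diagEmb hS),
      Measure.map_apply measurable_fst (measurable_adiagEmb hS)]
    rfl
  rw [hRHS]
  -- pieces
  have e1 : S ∩ Dp = A ∩ Dp := by
    ext p; simp only [mem_inter_iff, hA, mem_setOf_eq, hDp]
    constructor
    · rintro ⟨hs, hd, h0⟩
      exact ⟨by rw [show ((p.1, p.1) : ℝ × ℝ) = p from Prod.ext rfl hd.symm]; exact hs, hd, h0⟩
    · rintro ⟨hs, hd, h0⟩
      exact ⟨by rw [show p = (p.1, p.1) from Prod.ext rfl hd]; exact hs, hd, h0⟩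
  have e2 : S ∩ Dm = B ∩ Dm := by
    ext p; simp only [mem_inter_iff, hB, mem_setOf_eq, hDm]
    constructor
    · rintro ⟨hs, hd, h0⟩
      exact ⟨by rw [show ((p.1, -p.1) : ℝ × ℝ) = p from Prod.ext rfl hd.symm]; exact hs, hd, h0⟩
    · rintro ⟨hs, hd, h0⟩
      exact ⟨by rw [show p = (p.1, -p.1) from Prod.ext rfl hd]; exact hs, hd, h0⟩
  have e3 : A ∩ O = S ∩ O := by
    ext p; simp only [mem_inter_iff, hA, mem_setOf_eq, hO]
    constructor
    · rintro ⟨hs, h0, hb⟩; refine ⟨?_, h0, hb⟩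
      have : p = (p.1, p.1) := Prod.ext rfl (by rw [hb, h0])
      rwa [this]
    · rintro ⟨hs, h0, hb⟩; refine ⟨?_, h0, hb⟩
      have : p = (p.1, p.1) := Prod.ext rfl (by rw [hb, h0])
      rwa [← this]
  have e4 : B ∩ O = S ∩ O := by
    ext p; simp only [mem_inter_iff, hB, mem_setOf_eq, hO]
    constructor
    · rintro ⟨hs, h0, hb⟩; refine ⟨?_, h0, hb⟩
      have : p = (p.1, -p.1) := Prod.ext rfl (by rw [hb, h0, neg_zero])
      rwa [this]
    · rintro ⟨hs, h0, hb⟩; refine ⟨?_, h0, hb⟩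
      have : p = (p.1, -p.1) := Prod.ext rfl (by rw [hb, h0, neg_zero])
      rwa [← this]
  -- reflection moves `Dm` to `Dp` on `A` and `B`
  have hreflA : μ (A ∩ Dm) = μ (A ∩ Dp) := by
    have : (fun p : ℝ × ℝ => (p.1, -p.2)) ⁻¹' (A ∩ Dp) = A ∩ Dm := by
      ext p
      simp only [mem_preimage, mem_inter_iff, hA, mem_setOf_eq, hDp, hDm, neg_eq_iff_eq_neg]
    rw [← this, ← Measure.map_apply hR (mA.inter mDp), hrefl]
  have hreflB : μ (B ∩ Dp) = μ (B ∩ Dm) := by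
    have : (fun p : ℝ × ℝ => (p.1, -p.2)) ⁻¹' (B ∩ Dm) = B ∩ Dp := by
      ext p
      simp only [mem_preimage, mem_inter_iff, hB, mem_setOf_eq, hDp, hDm, neg_inj]
    rw [← this, ← Measure.map_apply hR (mB.inter mDm), hrefl]
  rw [hdec S hS, hdec A mA, hdec B mB, e1, e2, e3, e4, hreflA, hreflB]
  -- arithmetic: `x = 2⁻¹ (2x)`
  rw [show μ (A ∩ Dp) + μ (A ∩ Dp) + μ (S ∩ O) + (μ (B ∩ Dm) + μ (B ∩ Dm) + μ (S ∩ O)) =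
      2 * (μ (A ∩ Dp) + μ (B ∩ Dm) + μ (S ∩ O)) by ring, ← mul_assoc, ENNReal.inv_mul_cancel (by norm_num) (by norm_num),
    one_mul]

/-! ## 2. The first marginal from its Laplace transform -/

/-- `∫₀^∞ e^{-xa} (σ²/2π) da = σ²/(2πx)`: the Laplace transform of `a · σ²/(2πa) da`.
[cite: DKLM2026SixVertexGFF, Part II, proof of Theorem 53] -/
theorem lintegral_gffRadial_mul_exp_neg (σ : ℝ) {x : ℝ} (hx : 0 < x) :
    ∫⁻ a, ENNReal.ofReal (a * Real.exp (-(a * x))) ∂gffRadial σ = ENNReal.ofReal (σ ^ 2 / (2 * Real.pi * x)) := by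
  rw [gffRadial, lintegral_withDensity_eq_lintegral_mul _ (measurable_gffDensity σ).coe_nnreal_ennreal
    (show Measurable (fun a : ℝ => ENNReal.ofReal (a * Real.exp (-(a * x)))) from
      (measurable_id.mul (Real.measurable_exp.comp (measurable_id.mul_const x).neg)).ennreal_ofReal)]
  have heq : ∀ a ∈ Ioi (0 : ℝ), ((fun a => ((gffDensity σ a : ℝ≥0) : ℝ≥0∞)) * fun a => ENNReal.ofReal (a * Real.exp (-(a * x)))) a =
      ENNReal.ofReal (σ ^ 2 / (2 * Real.pi) * Real.exp (-(x * a))) := by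
    intro a ha
    simp only [Pi.mul_apply]
    rw [show ((gffDensity σ a : ℝ≥0) : ℝ≥0∞) = ENNReal.ofReal (σ ^ 2 / (2 * Real.pi * a)) from rfl,
      ← ENNReal.ofReal_mul (by have := mem_Ioi.1 ha; positivity)]
    congr 1
    have ha' : a ≠ 0 := ne_of_gt ha
    field_simp
  rw [setLIntegral_congr_fun measurableSet_Ioi heq]
  have hint : IntegrableOn (fun a : ℝ => σ ^ 2 / (2 * Real.pi) * Real.exp (-(x * a))) (Ioi 0) := by
    have := (exp_neg_integrableOn_Ioi 0 hx).const_mul (σ ^ 2 / (2 * Real.pi))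
    exact IntegrableOn.congr_fun this (fun a _ => by ring_nf) measurableSet_Ioi
  rw [← ofReal_integral_eq_lintegral_ofReal hint (ae_of_all _ fun a => by positivity), integral_const_mul]
  congr 1
  have h := integral_exp_mul_Ioi (a := -x) (by linarith) 0
  have e : (fun a : ℝ => Real.exp (-(x * a))) = fun a => Real.exp (-x * a) := by funext a; ring_nf
  rw [e, h]
  simp only [mul_zero, Real.exp_zero]
  field_simp

/-- `a ↦ a` and `a ↦ a⁻¹` as `ℝ≥0∞`-densities multiply to the indicator of `(0,∞)`. [folklore] -/
theorem ofReal_mul_ofReal_inv_eq_indicator :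
    ((fun a : ℝ => ENNReal.ofReal a) * fun a : ℝ => ENNReal.ofReal a⁻¹) = (Ioi (0 : ℝ)).indicator 1 := by
  funext a
  simp only [Pi.mul_apply]
  rcases le_or_gt a 0 with ha | ha
  · rw [ENNReal.ofReal_of_nonpos ha, zero_mul, indicator_of_notMem (show a ∉ Ioi (0 : ℝ) from not_lt.2 ha)]
  · rw [← ENNReal.ofReal_mul ha.le, mul_inv_cancel₀ ha.ne', ENNReal.ofReal_one, indicator_of_mem (mem_Ioi.2 ha),
      Pi.one_apply]

/-- Undoing the density `a` on a measure carried by `(0,∞)`. [folklore] -/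
theorem withDensity_withDensity_inv_of_null {ρ : Measure ℝ} (hρ : ρ {a : ℝ | a ≤ 0} = 0) :
    (ρ.withDensity fun a => ENNReal.ofReal a).withDensity (fun a => ENNReal.ofReal a⁻¹) = ρ := by
  rw [← withDensity_mul _ ENNReal.measurable_ofReal (measurable_inv.ennreal_ofReal), ofReal_mul_ofReal_inv_eq_indicator,
    withDensity_indicator_one measurableSet_Ioi]
  refine Measure.restrict_eq_self_of_ae_mem ?_
  rw [ae_iff]
  have hsub : {a : ℝ | ¬a ∈ Ioi (0 : ℝ)} ⊆ {a : ℝ | a ≤ 0} := fun a ha => by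
    simp only [mem_setOf_eq, mem_Ioi, not_lt] at ha
    exact ha
  exact measure_mono_null hsub hρ

/-- **The first marginal is `σ²/(2πa) 𝟙_{a>0} da`** as soon as `∫ a e^{-ax} dμ = σ²/(2πx)` for all
`x > 0` and `μ` gives no mass to `{a ≤ 0}` ("since a `σ`-finite positive measure is uniquely
determined by its Laplace transform"). [cite: DKLM2026SixVertexGFF, Part II, proof of Theorem 53] -/
theorem fst_marginal_eq_gffRadial {μ : Measure (ℝ × ℝ)} (hμ0 : μ {p : ℝ × ℝ | p.1 ≤ 0} = 0) (σ : ℝ)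
    (hF : ∀ x : ℝ, 0 < x → ∫⁻ p, ENNReal.ofReal (p.1 * Real.exp (-(p.1 * x))) ∂μ = ENNReal.ofReal (σ ^ 2 / (2 * Real.pi * x))) :
    μ.map Prod.fst = gffRadial σ := by
  set μ₁ : Measure ℝ := μ.map Prod.fst with hμ₁
  have hμ₁0 : μ₁ {a : ℝ | a ≤ 0} = 0 := by
    rw [hμ₁, Measure.map_apply measurable_fst (show MeasurableSet {a : ℝ | a ≤ 0} from measurableSet_Iic)]
    exact hμ0
  have hrad0 : gffRadial σ {a : ℝ | a ≤ 0} = 0 := gffRadial_null_of_subset_nonpos σ (fun a ha => ha)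
  -- Laplace transforms of `a μ₁` and `a gffRadial`
  have hLμ : ∀ x : ℝ, 0 < x → ∫⁻ a, ENNReal.ofReal (Real.exp (-(x * a))) ∂μ₁.withDensity (fun a => ENNReal.ofReal a) =
      ENNReal.ofReal (σ ^ 2 / (2 * Real.pi * x)) := by
    intro x hx
    rw [lintegral_withDensity_eq_lintegral_mul _ ENNReal.measurable_ofReal
      (show Measurable (fun a : ℝ => ENNReal.ofReal (Real.exp (-(x * a)))) from
        (Real.measurable_exp.comp (measurable_id.const_mul x).neg).ennreal_ofReal), hμ₁,
      lintegral_map (show Measurable ((fun a : ℝ => ENNReal.ofReal a) * fun a => ENNReal.ofReal (Real.exp (-(x * a)))) from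
        ENNReal.measurable_ofReal.mul ((Real.measurable_exp.comp (measurable_id.const_mul x).neg).ennreal_ofReal))
        measurable_fst, ← hF x hx]
    refine lintegral_congr_ae ?_
    have : ∀ᵐ p ∂μ, p ∉ {p : ℝ × ℝ | p.1 ≤ 0} := compl_mem_ae_iff.2 hμ0
    filter_upwards [this] with p hp
    simp only [not_le] at hp
    simp only [Pi.mul_apply]
    rw [← ENNReal.ofReal_mul hp.le]
    ring_nf
  have hLrad : ∀ x : ℝ, 0 < x → ∫⁻ a, ENNReal.ofReal (Real.exp (-(x * a))) ∂(gffRadial σ).withDensity (fun a => ENNReal.ofReal a) =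
      ENNReal.ofReal (σ ^ 2 / (2 * Real.pi * x)) := by
    intro x hx
    rw [lintegral_withDensity_eq_lintegral_mul _ ENNReal.measurable_ofReal
      (show Measurable (fun a : ℝ => ENNReal.ofReal (Real.exp (-(x * a)))) from
        (Real.measurable_exp.comp (measurable_id.const_mul x).neg).ennreal_ofReal), ← lintegral_gffRadial_mul_exp_neg σ hx]
    refine lintegral_congr fun a => ?_
    simp only [Pi.mul_apply]
    rcases le_or_gt a 0 with ha | ha
    · rw [ENNReal.ofReal_of_nonpos ha, zero_mul, ENNReal.ofReal_of_nonpos (mul_nonpos_of_nonpos_of_nonneg ha (Real.exp_pos _).le)]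
    · rw [← ENNReal.ofReal_mul ha.le]; ring_nf
  -- uniqueness of Laplace transforms
  have hsub : Iio (0 : ℝ) ⊆ {a : ℝ | a ≤ 0} := fun a (ha : a < 0) => (ha.le : a ≤ 0)
  have hnull : ∀ ρ : Measure ℝ, ρ {a : ℝ | a ≤ 0} = 0 → (ρ.withDensity fun a => ENNReal.ofReal a) (Iio 0) = 0 :=
    fun ρ hρ => withDensity_absolutelyContinuous _ _ (measure_mono_null hsub hρ)
  have key := ext_of_forall_lintegral_exp_neg_nat_mul_eq (hnull μ₁ hμ₁0) (hnull _ hrad0)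
    (by rw [show (fun a : ℝ => ENNReal.ofReal (Real.exp (-a))) = fun a => ENNReal.ofReal (Real.exp (-(1 * a))) by simp,
      hLμ 1 one_pos]; exact ENNReal.ofReal_ne_top)
    (by rw [show (fun a : ℝ => ENNReal.ofReal (Real.exp (-a))) = fun a => ENNReal.ofReal (Real.exp (-(1 * a))) by simp,
      hLrad 1 one_pos]; exact ENNReal.ofReal_ne_top)
    (fun n => by rw [hLμ _ (by positivity), hLrad _ (by positivity)])
  rw [← withDensity_withDensity_inv_of_null hμ₁0, ← withDensity_withDensity_inv_of_null hrad0, key]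

/-! ## 3. Theorem 53: identification of the limit -/

/-- **Theorem 53 (identification step).** A positive measure `μ` on `ℝ × ℝ` with no mass on `{a ≤ 0}`,
invariant under `(a,b) ↦ (a,-b)`, concentrated on `{|b| = a}` and with
`∫ a e^{-ax} dμ(a,b) = σ²/(2πx)` for every `x > 0` (i.e. `F(x,0) = σ²/(2πx)`) is the GFF spectral
measure `μ_σ = ½(δ_{b=a} + δ_{b=-a}) ⊗ σ²/(2πa) 𝟙_{a>0} da`.
[cite: DKLM2026SixVertexGFF, Part II, Theorem 53 and its proof] -/
theorem eq_gffSpectralMeasure_of_laplace {μ : Measure (ℝ × ℝ)} (hμ0 : μ {p : ℝ × ℝ | p.1 ≤ 0} = 0)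
    (hrefl : μ.map (fun p : ℝ × ℝ => (p.1, -p.2)) = μ) (hconc : μ {p : ℝ × ℝ | |p.2| ≠ p.1} = 0) (σ : ℝ)
    (hF : ∀ x : ℝ, 0 < x → ∫⁻ p, ENNReal.ofReal (p.1 * Real.exp (-(p.1 * x))) ∂μ = ENNReal.ofReal (σ ^ 2 / (2 * Real.pi * x))) :
    μ = gffSpectralMeasure σ := by
  rw [measure_eq_half_sum_map_of_concentrated hrefl hconc, fst_marginal_eq_gffRadial hμ0 σ hF]
  rfl

/-! ## 4. The hypotheses in the language of Definition 36 (`F`, `I_F`) for `μ ∈ 𝓜_{c,C}` -/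

section FromF

variable {c C : ℝ} {μ : Measure (ℝ × ℝ)}

/-- For `μ ∈ 𝓜_{c,C}`, `F(x,0) = σ²/(2πx)` (real part; `F(x,0)` is real) is the Laplace-type identity
`∫ a e^{-ax} dμ = σ²/(2πx)` in `ℝ≥0∞` form. [cite: DKLM2026SixVertexGFF, Part II, proof of Theorem 53] -/
theorem lintegral_eq_of_dklmF_re_eq (h : μ ∈ dklmSpaceM c C) {σ x : ℝ} (hx : 0 < x)
    (hF : (dklmF μ x 0).re = σ ^ 2 / (2 * Real.pi * x)) :
    ∫⁻ p, ENNReal.ofReal (p.1 * Real.exp (-(p.1 * x))) ∂μ = ENNReal.ofReal (σ ^ 2 / (2 * Real.pi * x)) := by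
  have hint : Integrable (fun p : ℝ × ℝ => p.1 * Real.exp (-(p.1 * x))) μ := by
    refine dklmSpaceM_integrable h (K := max 1 (2 / x ^ 2)) (Continuous.continuousOn (by fun_prop)) (by positivity)
      fun p hp => ?_
    rw [Real.norm_eq_abs, abs_of_pos (mul_pos hp (Real.exp_pos _))]
    exact mul_exp_neg_le_min_inv hp hx
  rw [← hF, dklmF_ofReal_zero μ x, Complex.ofReal_re, ofReal_integral_eq_lintegral_ofReal hint]
  filter_upwards [dklmSpaceM_ae_pos h] with p hp
  exact (mul_pos hp (Real.exp_pos _)).le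

/-- **From `I_F(s) - I_F(1) = -(σ²/2π) log s` to `F(s,0) = σ²/(2πs)`** (differentiate: `I_F' = -F(·,0)`).
[cite: DKLM2026SixVertexGFF, Part II, proof of Theorem 53] -/
theorem dklmF_re_eq_of_dklmIF_eq (h : μ ∈ dklmSpaceM c C) {σ : ℝ}
    (hI : ∀ s : ℝ, 0 < s → dklmIF μ s = dklmIF μ 1 - σ ^ 2 / (2 * Real.pi) * Real.log s) {s : ℝ} (hs : 0 < s) :
    (dklmF μ s 0).re = σ ^ 2 / (2 * Real.pi * s) := by
  have h1 : HasDerivAt (dklmIF μ) (-(dklmF μ s 0).re) s := hasDerivAt_dklmIF h hs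
  have h2 : HasDerivAt (fun t : ℝ => dklmIF μ 1 - σ ^ 2 / (2 * Real.pi) * Real.log t) (-(σ ^ 2 / (2 * Real.pi) * s⁻¹)) s := by
    have := ((Real.hasDerivAt_log hs.ne').const_mul (σ ^ 2 / (2 * Real.pi))).const_sub (dklmIF μ 1)
    simpa using this
  have heq : dklmIF μ =ᶠ[𝓝 s] fun t : ℝ => dklmIF μ 1 - σ ^ 2 / (2 * Real.pi) * Real.log t := by
    filter_upwards [isOpen_Ioi.mem_nhds hs] with t ht
    exact hI t ht
  have h3 : HasDerivAt (dklmIF μ) (-(σ ^ 2 / (2 * Real.pi) * s⁻¹)) s := heq.hasDerivAt_iff.2 h2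
  have := h1.unique h3
  rw [neg_inj] at this
  rw [this]
  field_simp

/-- **Theorem 53 (identification step) for `μ ∈ 𝓜_{c,C}` in the language of Definition 36**: if `μ`
is concentrated on `{|b| = a}` and `F(x,0) = σ²/(2πx)` for all `x > 0`, then `μ = μ_σ`.
[cite: DKLM2026SixVertexGFF, Part II, Theorem 53 and its proof] -/
theorem eq_gffSpectralMeasure_of_dklmF (h : μ ∈ dklmSpaceM c C) (hconc : μ {p : ℝ × ℝ | |p.2| ≠ p.1} = 0) {σ : ℝ}
    (hF : ∀ x : ℝ, 0 < x → (dklmF μ x 0).re = σ ^ 2 / (2 * Real.pi * x)) : μ = gffSpectralMeasure σ :=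
  eq_gffSpectralMeasure_of_laplace (dklmSpaceM_nonpos_null h) (dklmSpaceM_map_reflect h) hconc σ
    fun x hx => lintegral_eq_of_dklmF_re_eq h hx (hF x hx)

/-- **Theorem 53 (identification step) from the `I_F` identity**: if `μ ∈ 𝓜_{c,C}` is concentrated on
`{|b| = a}` and `I_F(s) - I_F(1) = -(σ²/2π) log s` for all `s > 0` (convergence of `Φ₂^{(δ)}` to
`σ² Ψ₂^GFF` and eq. (Psi_in_terms_of_I)), then `μ = μ_σ`. [cite: DKLM2026SixVertexGFF, Part II, Theorem 53 and its proof] -/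
theorem eq_gffSpectralMeasure_of_dklmIF (h : μ ∈ dklmSpaceM c C) (hconc : μ {p : ℝ × ℝ | |p.2| ≠ p.1} = 0) {σ : ℝ}
    (hI : ∀ s : ℝ, 0 < s → dklmIF μ s = dklmIF μ 1 - σ ^ 2 / (2 * Real.pi) * Real.log s) :
    μ = gffSpectralMeasure σ :=
  eq_gffSpectralMeasure_of_dklmF h hconc fun _ hx => dklmF_re_eq_of_dklmIF_eq h hI hx

end FromF

/-! ## 5. From `μ{|b| > a} = 0` (Theorem 40) and `-Ξ'(1) = ∫ (a²-b²)e^{-a} dμ` (Theorem 46) -/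

section FromXi

variable {c C : ℝ} {μ : Measure (ℝ × ℝ)}

/-- **`∫ (a²-b²) e^{-a} dμ = 0` forces `μ{|b| < a} = 0`** once `μ{|b| > a} = 0` (the integrand is then
a.e. nonnegative and dominated by `a² e^{-a}`): the step "We therefore obtain that `μ[{|b|<a}] = 0`"
of the proof of Theorem 53. [cite: DKLM2026SixVertexGFF, Part II, proof of Theorem 53] -/
theorem concentrated_of_integral_sq_sub_sq_eq_zero (h : μ ∈ dklmSpaceM c C)
    (hup : μ {p : ℝ × ℝ | p.1 < |p.2|} = 0)
    (hint : ∫ p, (p.1 ^ 2 - p.2 ^ 2) * Real.exp (-p.1) ∂μ = 0) :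
    μ {p : ℝ × ℝ | |p.2| ≠ p.1} = 0 := by
  have hae_le : ∀ᵐ p ∂μ, |p.2| ≤ p.1 := by
    have : ∀ᵐ p ∂μ, p ∉ {p : ℝ × ℝ | p.1 < |p.2|} := compl_mem_ae_iff.2 hup
    filter_upwards [this] with p hp
    simpa using hp
  have hpos := dklmSpaceM_ae_pos h
  -- integrability, by domination with `a² e^{-a}`
  have hdom : Integrable (fun p : ℝ × ℝ => p.1 ^ 2 * Real.exp (-(p.1 * 1))) μ := by
    refine dklmSpaceM_integrable h (K := max 1 (6 / 1 ^ 3)) (Continuous.continuousOn (by fun_prop)) (by positivity)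
      fun p hp => ?_
    rw [Real.norm_eq_abs, abs_of_pos (mul_pos (pow_pos hp 2) (Real.exp_pos _))]
    exact sq_mul_exp_neg_le_min_inv hp one_pos
  have hintble : Integrable (fun p : ℝ × ℝ => (p.1 ^ 2 - p.2 ^ 2) * Real.exp (-p.1)) μ := by
    refine hdom.mono' (Continuous.aestronglyMeasurable (by fun_prop)) ?_
    filter_upwards [hae_le, hpos] with p hle hp
    have hb : p.2 ^ 2 ≤ p.1 ^ 2 := by
      have := abs_le_abs_of_nonneg (abs_nonneg p.2) hle
      nlinarith [sq_abs p.2, abs_nonneg p.2, sq_nonneg (p.1 - |p.2|)]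
    rw [Real.norm_eq_abs, abs_mul, abs_of_pos (Real.exp_pos _), abs_of_nonneg (by linarith), mul_one]
    exact mul_le_mul_of_nonneg_right (by nlinarith [sq_nonneg p.2]) (Real.exp_pos _).le
  have hnn : 0 ≤ᵐ[μ] fun p : ℝ × ℝ => (p.1 ^ 2 - p.2 ^ 2) * Real.exp (-p.1) := by
    filter_upwards [hae_le] with p hle
    have hb : p.2 ^ 2 ≤ p.1 ^ 2 := by nlinarith [sq_abs p.2, abs_nonneg p.2, sq_nonneg (p.1 - |p.2|)]
    exact mul_nonneg (by linarith) (Real.exp_pos _).le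
  have hzero := (integral_eq_zero_iff_of_nonneg_ae hnn hintble).1 hint
  -- a.e. `a² = b²`, hence `|b| = a`
  rw [← compl_mem_ae_iff]
  filter_upwards [hzero, hae_le, hpos] with p hp hle hapos
  simp only [Pi.zero_apply, mul_eq_zero, Real.exp_ne_zero, or_false] at hp
  simp only [mem_compl_iff, mem_setOf_eq, not_not]
  have h1 : |p.2| ^ 2 = p.1 ^ 2 := by rw [sq_abs]; linarith
  have := (sq_eq_sq₀ (abs_nonneg p.2) hapos.le).1 h1
  exact this

/-- **From the `I_F` identity, `Ξ ≡ σ²/2π` is constant, so `Ξ'(1) = 0`.**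
[cite: DKLM2026SixVertexGFF, Part II, proof of Theorem 53] -/
theorem hasDerivAt_dklmXi_zero_of_dklmIF_eq (h : μ ∈ dklmSpaceM c C) {σ : ℝ}
    (hI : ∀ s : ℝ, 0 < s → dklmIF μ s = dklmIF μ 1 - σ ^ 2 / (2 * Real.pi) * Real.log s) :
    HasDerivAt (dklmXi μ) 0 1 := by
  have heq : dklmXi μ =ᶠ[𝓝 (1 : ℝ)] fun _ => σ ^ 2 / (2 * Real.pi) := by
    filter_upwards [isOpen_Ioi.mem_nhds (show (1 : ℝ) ∈ Ioi (0 : ℝ) from mem_Ioi.2 one_pos)] with s hs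
    rw [dklmXi, dklmF_re_eq_of_dklmIF_eq h hI hs]
    have hs' : (s : ℝ) ≠ 0 := ne_of_gt hs
    field_simp
  exact heq.hasDerivAt_iff.2 (hasDerivAt_const _ _)

/-- **Theorem 53 (identification) from its analytic inputs**: for `μ ∈ 𝓜_{c,C}` with
`μ{|b| > a} = 0` (Theorem 40), `-Ξ'(1) = ∫ (a²-b²) e^{-a} dμ` (Theorem 46, eq. (non-increasing) at
`s = 1`) and `I_F(s) - I_F(1) = -(σ²/2π) log s` (convergence to `σ² Ψ₂^GFF`), `μ = μ_σ`.
[cite: DKLM2026SixVertexGFF, Part II, Theorem 53 and its proof] -/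
theorem eq_gffSpectralMeasure_of_upper_of_Xi (h : μ ∈ dklmSpaceM c C)
    (hup : μ {p : ℝ × ℝ | p.1 < |p.2|} = 0)
    (hXi : HasDerivAt (dklmXi μ) (-∫ p, (p.1 ^ 2 - p.2 ^ 2) * Real.exp (-p.1) ∂μ) 1) {σ : ℝ}
    (hI : ∀ s : ℝ, 0 < s → dklmIF μ s = dklmIF μ 1 - σ ^ 2 / (2 * Real.pi) * Real.log s) :
    μ = gffSpectralMeasure σ := by
  have h0 : -∫ p, (p.1 ^ 2 - p.2 ^ 2) * Real.exp (-p.1) ∂μ = 0 :=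
    hXi.unique (hasDerivAt_dklmXi_zero_of_dklmIF_eq h hI)
  exact eq_gffSpectralMeasure_of_dklmIF h
    (concentrated_of_integral_sq_sub_sq_eq_zero h hup (neg_eq_zero.1 h0)) hI

end FromXi

end Literature.Probability.LatticeModels.SixVertex

end
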